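import Summits.CriticalPhenomena.SAWScalingLimit.Theorems.LeftRightFKG.Negative.OrderCharacterisation
import Summits.CriticalPhenomena.SAWScalingLimit.Theorems.SAWLeftRightFKGLeftRightFKGStubMeshReduction
import HarnessLib

/-!
# Stub `stub_sweep` of line `excursion-domination` (crux `FKGToTraversalBound`)

The purely combinatorial **sweep lemma**: a closed lattice walk `C : c → c` of `ℤ²` and a finite
set `K` of sites, each joined to the support of `C` by a lattice walk through `K ∪ supp C`, can be
replaced by a closed walk `C' : c → c` with `supp C' = supp C ∪ K` such that, at every mesh
`δ > 0`, every point off the trace of `C'` is off the trace of `C` and has the same winding number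
for both polylines.

Proof. Induction on `#K`. If `K ⊆ supp C` take `C' = C`. Otherwise some `k₀ ∈ K ∖ supp C` is
joined to `supp C`; the last vertex `x ∉ supp C` of the joining walk before it enters `supp C` lies
in `K` and is lattice-adjacent to a vertex `y` of `C`. Splice the detour `y → x → y` into `C` at an
occurrence of `y` (`takeUntil` / `dropUntil`): the support grows by `{x}`, the trace grows, and off
the new trace the winding number is unchanged — rescale to mesh `1` (`wind_const_mul_sub`), join
`z` inside its closed face to the face centre off the trace (`wind_sub_eq_of_mem_connectedComponentIn`),
where the winding number is minus the signed crossing count (`wind_poly_probeL`), which is additive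
(`wcross_append`) and vanishes on the detour (`edgeCross_symm`). The set `K ∖ {x}` satisfies the
hypothesis for the spliced walk, and the induction hypothesis finishes.
-/

noncomputable section

open Set Complex Literature.Probability.LatticeModels Literature.Probability.RandomPlanarGeometry
open Literature.Topology.PlaneTopology
open Summit.CriticalPhenomena.SAWScalingLimit.Theorems.LeftRightFKG.Negative
open Summit.CriticalPhenomena.SAWScalingLimit.Theorems.LeftRightFKG.CornerLoc

namespace Summit.CriticalPhenomena.SAWScalingLimit.Theorems.FKGToTraversalBound.ExcursionDomination

/-! ## Traces of appended walks -/

section Append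

variable {G : SimpleGraph (Site 2)}

/-- The trace of an appended walk is the union of the two traces. [folklore] -/
theorem range_poly_append : ∀ {u v w : Site 2} (p : G.Walk u v) (r : G.Walk v w),
    range (poly u (p.append r).support.tail) =
      range (poly u p.support.tail) ∪ range (poly v r.support.tail)
  | u, _, _, SimpleGraph.Walk.nil, r => by
    rw [SimpleGraph.Walk.nil_append, SimpleGraph.Walk.support_nil, List.tail_cons]
    have h : range (poly u ([] : List (Site 2))) = {pt u} := by
      show range (Path.refl (pt u)) = {pt u}
      exact Path.refl_range
    rw [h, eq_comm, Set.union_eq_right]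
    rintro _ rfl
    exact ⟨0, (poly u r.support.tail).source⟩
  | u, _, _, SimpleGraph.Walk.cons (v := v') h p, r => by
    rw [SimpleGraph.Walk.cons_append, SimpleGraph.Walk.support_cons, SimpleGraph.Walk.support_cons,
      List.tail_cons, List.tail_cons, ← (p.append r).cons_tail_support, ← p.cons_tail_support,
      range_poly_cons, range_poly_cons, range_poly_append p r, Set.union_assoc]

/-- Heights of finitely many sites are bounded. [folklore] -/
theorem exists_forall_height_le (l : List (Site 2)) : ∃ Y : ℤ, ∀ x ∈ l, x 1 ≤ Y := by
  classical
  obtain ⟨Y, hY⟩ := Finset.exists_le ((l.map fun x : Site 2 => x 1).toFinset)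
  exact ⟨Y, fun x hx => hY _ (List.mem_toFinset.2 (List.mem_map.2 ⟨x, hx, rfl⟩))⟩

/-- Along a walk from a vertex outside `Q` to a vertex inside `Q`, all of whose vertices satisfy
`P ∨ Q`, some `P`-vertex outside `Q` is adjacent to a vertex of `Q`. [folklore] -/
theorem exists_adj_of_walk {V : Type*} {H : SimpleGraph V} {P Q : V → Prop} :
    ∀ {u v : V} (p : H.Walk u v), ¬ Q u → Q v → (∀ x ∈ p.support, P x ∨ Q x) →
      ∃ x y : V, P x ∧ ¬ Q x ∧ Q y ∧ H.Adj x y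
  | _, _, SimpleGraph.Walk.nil, hu, hv, _ => (hu hv).elim
  | u, _, SimpleGraph.Walk.cons (v := w) h p, hu, hv, hs => by
    by_cases hw : Q w
    · refine ⟨u, w, ?_, hu, hw, h⟩
      rcases hs u (by simp) with h' | h'
      exacts [h', (hu h').elim]
    · exact exists_adj_of_walk p hw hv fun x hx => hs x (by simp [hx])

end Append

/-! ## Winding numbers of closed lattice walks off the trace -/

/-- Off the trace, the winding number of a closed lattice polyline about `z` equals the one about
the centre of the face `(⌊re z⌋, ⌊im z⌋)` (join `z` to the centre inside the closed face).
[folklore] -/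
theorem wind_poly_eq_wind_probeL (a : Site 2) (l : List (Site 2))
    (hc : List.IsChain (zdGraph 2).Adj (a :: l))
    (hend : (polylineFrom (pt a) (l.map pt)).1 = pt a) {z : ℂ} (hz : z ∉ range (poly a l)) :
    wind (fun t => (poly a l).extend t - z) =
      wind (fun t => (poly a l).extend t - probeL ⌊z.re⌋ ⌊z.im⌋) := by
  set P := poly a l with hP
  set m := ⌊z.re⌋ with hm
  set k := ⌊z.im⌋ with hk
  have hseg : segment ℝ (probeL m k) z ⊆ (range P)ᶜ := by
    rw [segment_symm, ← insert_endpoints_openSegment]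
    rintro y (rfl | rfl | hy)
    · exact hz
    · exact probeL_not_mem_range_poly m k hc
    · intro hyP
      have hyF := openSegment_subset_openFace (Int.floor_le z.re) (Int.lt_floor_add_one z.re).le
        (Int.floor_le z.im) (Int.lt_floor_add_one z.im).le hy
      exact not_int_of_mem_openFace hyF (exists_int_of_mem_range_poly a _ hc y hyP)
  have hK : IsClosed (range P) := (isCompact_range P.continuous).isClosed
  have hcc : z ∈ connectedComponentIn (range P)ᶜ (probeL m k) :=
    (convex_segment _ _).isPreconnected.subset_connectedComponentIn (left_mem_segment _ _ _) hseg
      (right_mem_segment _ _ _)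
  have h01 : P.extend 0 = P.extend 1 := by rw [Path.extend_zero, Path.extend_one, hend]
  exact (wind_sub_eq_of_mem_connectedComponentIn P.continuous_extend.continuousOn h01 hK
    (fun t ht => by rw [Path.extend_apply P ht]; exact ⟨_, rfl⟩) hcc).symm

/-- Off the trace, the winding number of a closed lattice walk about `z` is minus its signed
crossing count over the probe of the face of `z`. [folklore] -/
theorem wind_walk_eq_neg_wcross {c : Site 2} (w : (zdGraph 2).Walk c c) {z : ℂ}
    (hz : z ∉ range (poly c w.support.tail)) {Y : ℤ} (hY : ∀ x ∈ w.support, x 1 ≤ Y)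
    (hk : ⌊z.im⌋ ≤ Y) :
    wind (fun t => (poly c w.support.tail).extend t - z) = -wcross ⌊z.re⌋ ⌊z.im⌋ w := by
  have hchain := isChain_support (G := zdGraph 2) (fun _ _ h => h) w
  rw [wind_poly_eq_wind_probeL c _ hchain (poly_fst_walk w) hz]
  have key := wind_poly_probeL (m := ⌊z.re⌋) hk c w.support.tail hchain
    (hY c w.start_mem_support) (fun x hx => hY x (List.mem_of_mem_tail hx)) (poly_fst_walk w)
  unfold wcross
  exact_mod_cast key

/-! ## One splice -/

/-- **Splicing an out-and-back detour.** For a vertex `q` of a closed lattice walk `C` and a lattice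
neighbour `k` of `q`, the walk `C₁` obtained by inserting `q → k → q` at an occurrence of `q` has
support `supp C ∪ {k}`, its trace contains the trace of `C`, and off its trace the winding numbers
of `C₁` and `C` agree. [folklore] -/
theorem splice_spec {c q k : Site 2} (C : (zdGraph 2).Walk c c) (hq : q ∈ C.support)
    (hqk : (zdGraph 2).Adj q k) :
    ∃ C₁ : (zdGraph 2).Walk c c,
      (∀ x, x ∈ C₁.support ↔ x ∈ C.support ∨ x = k) ∧
      ∀ z : ℂ, z ∉ range (poly c C₁.support.tail) →
        z ∉ range (poly c C.support.tail) ∧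
        wind (fun t => (poly c C₁.support.tail).extend t - z) =
          wind (fun t => (poly c C.support.tail).extend t - z) := by
  classical
  obtain ⟨D, hDsupp, hDwc⟩ : ∃ D : (zdGraph 2).Walk q q, D.support = [q, k, q] ∧
      ∀ m n : ℤ, wcross m n D = 0 := by
    refine ⟨SimpleGraph.Walk.cons hqk (SimpleGraph.Walk.cons hqk.symm SimpleGraph.Walk.nil), rfl,
      fun m n => ?_⟩
    unfold wcross
    simp only [SimpleGraph.Walk.support_cons, SimpleGraph.Walk.support_nil, List.tail_cons,
      pathCross_cons, pathCross_nil, edgeCross_symm m n q k]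
    ring
  set A := C.takeUntil q hq with hA
  set B := C.dropUntil q hq with hB
  have hC : A.append B = C := SimpleGraph.Walk.take_spec C hq
  have h1 : ∀ x, x ∈ C.support ↔ x ∈ A.support ∨ x ∈ B.support := fun x => by
    rw [← SimpleGraph.Walk.mem_support_append_iff, hC]
  have hqB : q ∈ B.support := B.start_mem_support
  refine ⟨A.append (D.append B), fun x => ?_, ?_⟩
  · rw [SimpleGraph.Walk.mem_support_append_iff, SimpleGraph.Walk.mem_support_append_iff, h1 x,
      hDsupp]
    simp only [List.mem_cons, List.not_mem_nil, or_false]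
    constructor
    · rintro (h | (h | h | h) | h)
      · exact Or.inl (Or.inl h)
      · rw [h]; exact Or.inl (Or.inr hqB)
      · exact Or.inr h
      · rw [h]; exact Or.inl (Or.inr hqB)
      · exact Or.inl (Or.inr h)
    · rintro ((h | h) | h)
      · exact Or.inl h
      · exact Or.inr (Or.inr h)
      · exact Or.inr (Or.inl (Or.inr (Or.inl h)))
  · obtain ⟨Y₀, hY₀⟩ := exists_forall_height_le (A.append (D.append B)).support
    have hrange : range (poly c (A.append (D.append B)).support.tail) =
        range (poly c A.support.tail) ∪ (range (poly q D.support.tail) ∪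
          range (poly q B.support.tail)) := by
      rw [range_poly_append, range_poly_append]
    have hrangeC : range (poly c C.support.tail) =
        range (poly c A.support.tail) ∪ range (poly q B.support.tail) := by
      rw [← range_poly_append, hC]
    intro z hz
    have hzC : z ∉ range (poly c C.support.tail) := by
      rw [hrangeC]
      rw [hrange] at hz
      rintro (h | h)
      · exact hz (Or.inl h)
      · exact hz (Or.inr (Or.inr h))
    refine ⟨hzC, ?_⟩
    set Y := max Y₀ ⌊z.im⌋ with hYdef
    have hY : ∀ x ∈ (A.append (D.append B)).support, x 1 ≤ Y := fun x hx =>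
      (hY₀ x hx).trans (le_max_left _ _)
    have hYC : ∀ x ∈ C.support, x 1 ≤ Y := by
      intro x hx
      apply hY
      rw [SimpleGraph.Walk.mem_support_append_iff, SimpleGraph.Walk.mem_support_append_iff]
      rcases (h1 x).1 hx with h | h
      · exact Or.inl h
      · exact Or.inr (Or.inr h)
    rw [wind_walk_eq_neg_wcross _ hz hY (le_max_right _ _),
      wind_walk_eq_neg_wcross C hzC hYC (le_max_right _ _), wcross_append, wcross_append, hDwc]
    have e3 : wcross ⌊z.re⌋ ⌊z.im⌋ C = wcross ⌊z.re⌋ ⌊z.im⌋ A + wcross ⌊z.re⌋ ⌊z.im⌋ B := by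
      rw [← wcross_append, hC]
    rw [e3]
    ring

/-! ## The sweep at mesh `1` -/

/-- **Sweep lemma at mesh `1`** (polyline form), by induction on `#K`. [folklore] -/
theorem sweep_poly (c : Site 2) : ∀ (n : ℕ) (C : (zdGraph 2).Walk c c) (K : Finset (Site 2)),
    K.card ≤ n →
      (∀ k ∈ K, ∃ (q : Site 2) (p : (zdGraph 2).Walk k q), q ∈ C.support ∧
        ∀ x ∈ p.support, x ∈ K ∨ x ∈ C.support) →
      ∃ C' : (zdGraph 2).Walk c c,
        (∀ x : Site 2, x ∈ C'.support ↔ (x ∈ C.support ∨ x ∈ K)) ∧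
        ∀ z : ℂ, z ∉ range (poly c C'.support.tail) →
          z ∉ range (poly c C.support.tail) ∧
          wind (fun t => (poly c C'.support.tail).extend t - z) =
            wind (fun t => (poly c C.support.tail).extend t - z) := by
  classical
  intro n
  induction n with
  | zero =>
    intro C K hK _
    have hK0 : K = ∅ := Finset.card_eq_zero.1 (Nat.le_zero.1 hK)
    refine ⟨C, fun x => ?_, fun z hz => ⟨hz, rfl⟩⟩
    simp [hK0]
  | succ n ih =>
    intro C K hK hjoin
    by_cases hsub : ∃ k₀ ∈ K, k₀ ∉ C.support
    swap
    · refine ⟨C, fun x => ?_, fun z hz => ⟨hz, rfl⟩⟩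
      constructor
      · exact Or.inl
      · rintro (h | h)
        · exact h
        · by_contra hx
          exact hsub ⟨x, h, hx⟩
    obtain ⟨k₀, hk₀K, hk₀C⟩ := hsub
    obtain ⟨q, p, hq, hp⟩ := hjoin k₀ hk₀K
    obtain ⟨x, y, hxK, hxC, hyC, hxy⟩ :=
      exists_adj_of_walk (P := fun v => v ∈ K) (Q := fun v => v ∈ C.support) p hk₀C hq hp
    obtain ⟨C₁, hC₁supp, hC₁wind⟩ := splice_spec C hyC hxy.symm
    have hcard : (K.erase x).card ≤ n := by
      rw [Finset.card_erase_of_mem hxK]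
      omega
    obtain ⟨C', hC'supp, hC'wind⟩ := ih C₁ (K.erase x) hcard (by
      intro k hk
      rw [Finset.mem_erase] at hk
      obtain ⟨q', p', hq', hp'⟩ := hjoin k hk.2
      refine ⟨q', p', (hC₁supp q').2 (Or.inl hq'), fun w hw => ?_⟩
      rcases hp' w hw with h | h
      · by_cases hwx : w = x
        · exact Or.inr ((hC₁supp w).2 (Or.inr hwx))
        · exact Or.inl (Finset.mem_erase.2 ⟨hwx, h⟩)
      · exact Or.inr ((hC₁supp w).2 (Or.inl h)))
    refine ⟨C', fun w => ?_, fun z hz => ?_⟩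
    · rw [hC'supp, hC₁supp, Finset.mem_erase]
      constructor
      · rintro ((h | h) | h)
        · exact Or.inl h
        · exact Or.inr (h ▸ hxK)
        · exact Or.inr h.2
      · rintro (h | h)
        · exact Or.inl (Or.inl h)
        · by_cases hwx : w = x
          · exact Or.inl (Or.inr hwx)
          · exact Or.inr ⟨hwx, h⟩
    · obtain ⟨hz₁, e₁⟩ := hC'wind z hz
      obtain ⟨hz₀, e₀⟩ := hC₁wind z hz₁
      exact ⟨hz₀, e₁.trans e₀⟩

/-! ## Mesh `δ` -/

section Mesh

variable {G : SimpleGraph (Site 2)} {u v : Site 2}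

/-- The trace at mesh `δ` is `δ` times the trace at mesh `1`. [folklore] -/
theorem mem_range_toCurve_iff (w : G.Walk u v) {δ : ℝ} (hδ : δ ≠ 0) (z : ℂ) :
    z ∈ range (w.toCurve (meshPoint δ)) ↔ z / δ ∈ range (poly u w.support.tail) := by
  have hδ' : (δ : ℂ) ≠ 0 := ofReal_ne_zero.2 hδ
  have h1 : ∀ t, w.toCurve (meshPoint 1) t = (poly u w.support.tail) t := fun t => by
    rw [meshPoint_one_eq, toCurve_pt]; rfl
  constructor
  · rintro ⟨t, ht⟩
    refine ⟨t, ?_⟩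
    rw [toCurve_meshPoint_apply, h1] at ht
    rw [eq_div_iff hδ', ← ht, mul_comm]
  · rintro ⟨t, ht⟩
    refine ⟨t, ?_⟩
    rw [toCurve_meshPoint_apply, h1, ht, mul_div_cancel₀ z hδ']

/-- The winding number at mesh `δ` about `z` is the one at mesh `1` about `z / δ`. [folklore] -/
theorem wind_toCurve_meshPoint (w : G.Walk u v) {δ : ℝ} (hδ : δ ≠ 0) (z : ℂ) :
    wind (fun s : ℝ => IccExtend zero_le_one (w.toCurve (meshPoint δ)) s - z) =
      wind (fun s => (poly u w.support.tail).extend s - z / δ) := by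
  have hδ' : (δ : ℂ) ≠ 0 := ofReal_ne_zero.2 hδ
  rw [show (fun s : ℝ => IccExtend zero_le_one (w.toCurve (meshPoint δ)) s - z) =
      fun s => (δ : ℂ) * IccExtend zero_le_one (w.toCurve (meshPoint 1)) s - z from
    funext fun s => by rw [iccExtend_toCurve_meshPoint], wind_const_mul_sub hδ']
  simp only [iccExtend_toCurve_apply]

end Mesh

/-! ## The registered stub -/

/-- **SWEEP LEMMA** (registered stub `stub_sweep` of line `excursion-domination`): a closed lattice
walk `C : c → c` and a finite set `K` of sites, each joined to `supp C` through `K ∪ supp C`, admit a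
closed walk `C' : c → c` with `supp C' = supp C ∪ K` whose trace contains that of `C` and whose
winding number agrees with that of `C` off its trace, at every mesh `δ > 0`. [folklore] -/
theorem stub_sweep :
    ∀ (c : Site 2) (C : (zdGraph 2).Walk c c) (K : Finset (Site 2)),
      (∀ k ∈ K, ∃ (q : Site 2) (p : (zdGraph 2).Walk k q), q ∈ C.support ∧
        ∀ x ∈ p.support, x ∈ K ∨ x ∈ C.support) →
      ∃ C' : (zdGraph 2).Walk c c,
        (∀ x : Site 2, x ∈ C'.support ↔ (x ∈ C.support ∨ x ∈ K)) ∧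
        ∀ (δ : ℝ) (z : ℂ), 0 < δ → z ∉ Set.range (C'.toCurve (meshPoint δ)) →
          z ∉ Set.range (C.toCurve (meshPoint δ)) ∧
          Literature.Topology.PlaneTopology.wind
              (fun s : ℝ => Set.IccExtend zero_le_one (C'.toCurve (meshPoint δ)) s - z) =
            Literature.Topology.PlaneTopology.wind
              (fun s : ℝ => Set.IccExtend zero_le_one (C.toCurve (meshPoint δ)) s - z) := by
  intro c C K hK
  obtain ⟨C', hsupp, hwind⟩ := sweep_poly c K.card C K le_rfl hK
  refine ⟨C', hsupp, fun δ z hδ hz => ?_⟩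
  rw [mem_range_toCurve_iff C' hδ.ne'] at hz
  rw [mem_range_toCurve_iff C hδ.ne', wind_toCurve_meshPoint C' hδ.ne',
    wind_toCurve_meshPoint C hδ.ne']
  exact hwind (z / δ) hz

end Summit.CriticalPhenomena.SAWScalingLimit.Theorems.FKGToTraversalBound.ExcursionDomination

end
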